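import Literature.Geometry.Kaehler.EhresmannChartBallTrivialisation
import Literature.Geometry.Manifold.SmoothEmbeddingInverse
import HarnessLib

/-!
# The Ehresmann trivialisation over a holomorphic chart ball, WITH ITS INVERSE

Layer `Literature/Geometry/Kaehler` (carriers `IsProperHolomorphicSubmersion`, `IsFibreEmbedding`). Theorems only; no definition, no
named fact. Written by the prover seat `hodge-nonav-20241-p1` (g19, cell `hodge-nonav`) as brick K0b of prover-Bx g17's programme
«GRIFFITHS-HOLOMORPHY» (memo `HOME/memos/PROGRAMME-GRIFFITHS-HOLOMORPHY-Bx-g17.md`; target `Griffiths1968_holomorphicHodgeSubbundlesQP`,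
`--supports stmt-HodgeConjecture-19716`): prover-Ax's F-C1 `IsProperHolomorphicSubmersion.exists_chartBall_trivialisation`
(`EhresmannChartBallTrivialisation.lean`) builds, from the tree's Ehresmann theorem with base coordinate and translation law
(`Geometry.Manifold.exists_localTrivialisation_translate`: tube maps `Tr, Sr` with `Sr (u, Tr (u, y)) = y = Tr (u, Sr (u, y))`), the
trivialisation `Φ p x = Tr (τ (c⁻¹ p), ι s₀ x)` over a chart ball — and DROPS `Sr`. The consumer K5 (differentiability of the test
functionals) needs the retraction of the tube onto a fibre, i.e. the INVERSE chart `Λ : 𝒳 → EB × X s₀`,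
`Λ y = (c (π y), (ι s₀)⁻¹ (Sr (τ (π y), y)))`. This file re-runs F-C1's construction (same hypotheses, same eight clauses) and exports in
addition:

* (Λ0) `(Λ y).1 = c (π y)` for every `y`;
* (Λ1) `Λ` is `C^∞` (real structures) on the tube `π ⁻¹' (c⁻¹ '' ball)` (the inverse of the smooth embedding `ι s₀` is `C^∞` on its range,
  `Geometry/Manifold/SmoothEmbeddingInverse.contMDiffOn_invFun_range`);
* (Λ2) `Λ (Φ p x) = (p, x)` for `p ∈ ball`;
* (Λ3) `Φ (Λ y).1 (Λ y).2 = y` whenever `π y ∈ c⁻¹ '' ball`.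

`X s₀` is assumed nonempty (a total `Λ` with values in `EB × X s₀` needs it as soon as the tube is nonempty). Honest scope: local
differential-topology plumbing; nothing here says HC or any rung is proved.

## References

* [Kodaira2005] K. Kodaira, Complex Manifolds and Deformation of Complex Structures (2005), §2.3 Thm. 2.3, Thm. 2.5.
* [VoisinHodgeI2002] C. Voisin, Hodge Theory and Complex Algebraic Geometry I (2002), §9.1.1 Thm. 9.3, Prop. 9.5; §9.1.2.
* [BrockerJanichIDT1982] Th. Bröcker, K. Jänich, Introduction to Differential Topology (1982), (8.12).
* [LeeSmoothManifolds2013] J. M. Lee, Introduction to Smooth Manifolds, 2nd ed. (2013), Prop. 4.22, Thm. 5.31.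
-/

noncomputable section

open scoped Manifold ContDiff Topology
open Function Set Filter Metric
open Literature.Geometry.Manifold

namespace Literature.Geometry.Kaehler

universe u

-- The identification `TangentSpace I x = E` is an abuse of definitional equality; as in the tree's
-- manifold files we let `isDefEq` unfold it.
set_option backward.isDefEq.respectTransparency false

section ChartBall

variable {EX : Type u} [NormedAddCommGroup EX] [NormedSpace ℂ EX] [FiniteDimensional ℂ EX]
  {E𝒳 : Type u} [NormedAddCommGroup E𝒳] [NormedSpace ℂ E𝒳] [FiniteDimensional ℂ E𝒳]
  {𝒳 : Type u} [TopologicalSpace 𝒳] [ChartedSpace E𝒳 𝒳] [IsManifold 𝓘(ℂ, E𝒳) ω 𝒳]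
  [T2Space 𝒳] [SecondCountableTopology 𝒳]
  {EB : Type u} [NormedAddCommGroup EB] [NormedSpace ℂ EB] [FiniteDimensional ℂ EB]
  {B : Type u} [TopologicalSpace B] [ChartedSpace EB B] [IsManifold 𝓘(ℂ, EB) ω B]
  {π : 𝒳 → B}

/-- **The Ehresmann trivialisation of a proper holomorphic submersion over a holomorphic chart ball, with its inverse** (Kodaira
Thm. 2.5 ∕ Voisin I Thm. 9.3, Prop. 9.5 in the tree's local `C^∞` form `exists_localTrivialisation_translate`, reparametrised by the
chart `c = extChartAt 𝓘(ℂ, EB) s₀`). Data as in `exists_chartBall_trivialisation` (plus `X s₀` nonempty). Conclusion: `r > 0`,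
`Φ : EB → X s₀ → 𝒳` with F-C1's clauses (0)–(4) VERBATIM, and the inverse chart `Λ : 𝒳 → EB × X s₀` with (Λ0) `(Λ y).1 = c (π y)`,
(Λ1) `Λ` is `C^∞` on `π ⁻¹' (c⁻¹ '' ball)`, (Λ2) `Λ (Φ p x) = (p, x)` (`p ∈ ball`), (Λ3) `Φ (Λ y).1 (Λ y).2 = y` (`π y ∈ c⁻¹ '' ball`).
[cite: Kodaira2005, §2.3 Thm. 2.5 and Thm. 2.3] [cite: VoisinHodgeI2002, §9.1.1 Thm. 9.3 and Prop. 9.5]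
[cite: BrockerJanichIDT1982, (8.12)] [cite: LeeSmoothManifolds2013, Prop. 4.22 and Thm. 5.31] -/
theorem IsProperHolomorphicSubmersion.exists_chartBall_trivialisation_inverse
    (hπ : IsProperHolomorphicSubmersion E𝒳 EB π) {O : Set B} (hO : IsOpen O) {s₀ : B} (hs₀ : s₀ ∈ O)
    {X : B → Type u} [∀ b, TopologicalSpace (X b)] [∀ b, ChartedSpace EX (X b)]
    [∀ b, IsManifold 𝓘(ℂ, EX) ω (X b)] [Nonempty (X s₀)] {ι : ∀ b, X b → 𝒳}
    (hι : ∀ b ∈ O, IsFibreEmbedding EX E𝒳 π b (ι b)) :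
    ∃ (r : ℝ) (Φ : EB → X s₀ → 𝒳) (Λ : 𝒳 → EB × X s₀), 0 < r ∧
      ball (extChartAt 𝓘(ℂ, EB) s₀ s₀) r ⊆ (extChartAt 𝓘(ℂ, EB) s₀).target ∧
      (∀ p ∈ ball (extChartAt 𝓘(ℂ, EB) s₀ s₀) r, (extChartAt 𝓘(ℂ, EB) s₀).symm p ∈ O) ∧
      (∀ x, Φ (extChartAt 𝓘(ℂ, EB) s₀ s₀) x = ι s₀ x) ∧
      (∀ p ∈ ball (extChartAt 𝓘(ℂ, EB) s₀ s₀) r, ∀ x, π (Φ p x) = (extChartAt 𝓘(ℂ, EB) s₀).symm p) ∧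
      ContMDiffOn (𝓘(ℝ, EB).prod 𝓘(ℝ, EX)) 𝓘(ℝ, E𝒳) ∞ (uncurry Φ)
        (ball (extChartAt 𝓘(ℂ, EB) s₀ s₀) r ×ˢ univ) ∧
      (∀ p ∈ ball (extChartAt 𝓘(ℂ, EB) s₀ s₀) r,
        ContMDiff 𝓘(ℝ, EX) 𝓘(ℝ, E𝒳) ∞ (Φ p) ∧ Injective (Φ p) ∧
          (∀ x, Injective (mfderiv 𝓘(ℝ, EX) 𝓘(ℝ, E𝒳) (Φ p) x)) ∧
          range (Φ p) = π ⁻¹' {(extChartAt 𝓘(ℂ, EB) s₀).symm p}) ∧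
      (∀ p ∈ ball (extChartAt 𝓘(ℂ, EB) s₀ s₀) r,
        ∃ e : X s₀ ≃ₘ^∞⟮𝓘(ℝ, EX), 𝓘(ℝ, EX)⟯ X ((extChartAt 𝓘(ℂ, EB) s₀).symm p),
          ∀ x, ι ((extChartAt 𝓘(ℂ, EB) s₀).symm p) (e x) = Φ p x) ∧
      (∀ y, (Λ y).1 = extChartAt 𝓘(ℂ, EB) s₀ (π y)) ∧
      ContMDiffOn 𝓘(ℝ, E𝒳) (𝓘(ℝ, EB).prod 𝓘(ℝ, EX)) ∞ Λ
        (π ⁻¹' ((extChartAt 𝓘(ℂ, EB) s₀).symm '' ball (extChartAt 𝓘(ℂ, EB) s₀ s₀) r)) ∧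
      (∀ p ∈ ball (extChartAt 𝓘(ℂ, EB) s₀ s₀) r, ∀ x, Λ (Φ p x) = (p, x)) ∧
      (∀ y, π y ∈ (extChartAt 𝓘(ℂ, EB) s₀).symm '' ball (extChartAt 𝓘(ℂ, EB) s₀ s₀) r →
        Φ (Λ y).1 (Λ y).2 = y) := by
  haveI : IsManifold 𝓘(ℝ, E𝒳) ∞ 𝒳 := isManifold_real_of_isManifold_complex
  haveI : IsManifold 𝓘(ℝ, EB) ∞ B := isManifold_real_of_isManifold_complex
  haveI : ∀ b, IsManifold 𝓘(ℝ, EX) ∞ (X b) := fun b ↦ isManifold_real_of_isManifold_complex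
  haveI : FiniteDimensional ℝ EX := FiniteDimensional.complexToReal EX
  haveI : FiniteDimensional ℝ E𝒳 := FiniteDimensional.complexToReal E𝒳
  haveI : FiniteDimensional ℝ EB := FiniteDimensional.complexToReal EB
  haveI : CompleteSpace EB := FiniteDimensional.complete ℂ EB
  -- Ehresmann over `O`
  have hπℝ : ContMDiff 𝓘(ℝ, E𝒳) 𝓘(ℝ, EB) ∞ π :=
    contMDiff_real_of_mdifferentiable (hπ.contMDiff.mdifferentiable (by simp))
  have hsub : ∀ x, π x ∈ O → Surjective (mfderiv 𝓘(ℝ, E𝒳) 𝓘(ℝ, EB) π x) :=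
    fun x _ ↦ hπ.surjective_mfderiv_real x
  have hprop : ∀ K ⊆ O, IsCompact K → IsCompact (π ⁻¹' K) :=
    fun K _ hK ↦ hπ.isProperMap.isCompact_preimage hK
  obtain ⟨V, W, τ, Tr, Sr, hVo, hs₀V, hVO, -, hW, hτ, hτinj, hτ₀, hTr, hSr, hTrW, hSrW, hSrTr, hTrSr,
    hTr0, hlaw⟩ :=
    Literature.Geometry.Manifold.exists_localTrivialisation_translate (IT := 𝓘(ℝ, E𝒳)) hπℝ hO hs₀
      hsub hprop
  have hWo : IsOpen W := hW ▸ hVo.preimage hπ.contMDiff.continuous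
  -- the chart `c` at `s₀` and a ball in its target over `V`
  set c := extChartAt 𝓘(ℂ, EB) s₀ with hc
  have hcℝ : extChartAt 𝓘(ℝ, EB) s₀ = c := rfl
  have hs₀c : s₀ ∈ c.source := mem_extChartAt_source s₀
  have hG : IsOpen (c.target ∩ c.symm ⁻¹' V) :=
    (continuousOn_extChartAt_symm s₀).isOpen_inter_preimage (isOpen_extChartAt_target s₀) hVo
  have hG₀ : c s₀ ∈ c.target ∩ c.symm ⁻¹' V :=
    ⟨c.map_source hs₀c, by rw [mem_preimage, extChartAt_to_inv]; exact hs₀V⟩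
  obtain ⟨r, hr, hball⟩ := Metric.isOpen_iff.1 hG (c s₀) hG₀
  have hbt : ball (c s₀) r ⊆ c.target := fun p hp ↦ (hball hp).1
  have hbV : ∀ p ∈ ball (c s₀) r, c.symm p ∈ V := fun p hp ↦ (hball hp).2
  -- fibres over `V` lie in the tube; `π` maps the tube to `V`
  have hfibW : ∀ b ∈ V, π ⁻¹' {b} ⊆ W := fun b hb y hy ↦ by
    rw [hW]
    have : π y = b := by simpa using hy
    simpa [this] using hb
  have hπW : ∀ y ∈ W, π y ∈ V := fun y hy ↦ by rwa [hW] at hy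
  have hι₀ := hι s₀ hs₀
  have hι₀W : ∀ x, ι s₀ x ∈ W := fun x ↦ hfibW s₀ hs₀V (by simpa using hι₀.apply_eq x)
  -- the trivialisation
  set Φ : EB → X s₀ → 𝒳 := fun p x ↦ Tr (τ (c.symm p), ι s₀ x) with hΦ
  -- (1) `π (Φ p x) = c⁻¹ p`
  have hπΦ : ∀ p ∈ ball (c s₀) r, ∀ x, π (Φ p x) = c.symm p := by
    intro p hp x
    apply hτinj (hπW _ (hTrW _ _ (hι₀W x))) (hbV p hp)
    rw [hlaw _ _ (hι₀W x), hι₀.apply_eq x, hτ₀, zero_add]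
  -- the slices `Tr (u, ·)`, `Sr (u, ·)`
  have hslice : ∀ (u) {F : EuclideanSpace ℝ (Fin (Module.finrank ℝ EB)) × 𝒳 → 𝒳},
      ContMDiffOn ((𝓘(ℝ, EuclideanSpace ℝ (Fin (Module.finrank ℝ EB)))).prod 𝓘(ℝ, E𝒳))
        𝓘(ℝ, E𝒳) ∞ F (univ ×ˢ W) →
      ContMDiffOn 𝓘(ℝ, E𝒳) 𝓘(ℝ, E𝒳) ∞ (fun y ↦ F (u, y)) W := fun u {F} hF ↦
    hF.comp (contMDiffOn_const.prodMk contMDiffOn_id) fun y hy ↦ ⟨mem_univ _, hy⟩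
  -- (3) each `Φ p` is a `C^∞` injective immersion onto its fibre
  have himm : ∀ p ∈ ball (c s₀) r,
      ContMDiff 𝓘(ℝ, EX) 𝓘(ℝ, E𝒳) ∞ (Φ p) ∧ Injective (Φ p) ∧
        (∀ x, Injective (mfderiv 𝓘(ℝ, EX) 𝓘(ℝ, E𝒳) (Φ p) x)) ∧
        range (Φ p) = π ⁻¹' {c.symm p} := by
    intro p hp
    set u := τ (c.symm p) with hu
    have hAb : ∀ y, π y = s₀ → π (Tr (u, y)) = c.symm p := fun y hy ↦ by
      have hyW : y ∈ W := hfibW s₀ hs₀V (by simpa using hy)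
      apply hτinj (hπW _ (hTrW u y hyW)) (hbV p hp)
      rw [hlaw u y hyW, hy, hτ₀, zero_add]
    have hA'b : ∀ y, π y = c.symm p → π (Sr (u, y)) = s₀ ∧ Tr (u, Sr (u, y)) = y := fun y hy ↦ by
      have hyW : y ∈ W := hfibW _ (hbV p hp) (by simpa using hy)
      refine ⟨?_, hTrSr u y hyW⟩
      apply hτinj (hπW _ (hSrW u y hyW)) hs₀V
      have h := hlaw u (Sr (u, y)) (hSrW u y hyW)
      rw [hTrSr u y hyW, hy] at h
      rw [hτ₀]
      have h' : τ (π (Sr (u, y))) = τ (c.symm p) - u := by rw [h]; abel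
      rw [h', hu, sub_self]
    exact immersedFibre_comp hWo (hslice u hTr) (hslice u hSr) (fun y hy ↦ hTrW u y hy)
      (fun y hy ↦ hSrTr u y hy) (hfibW s₀ hs₀V) hAb hA'b hι₀.contMDiff_real
      hι₀.isClosedEmbedding.injective hι₀.injective_mfderiv_real hι₀.range_eq
  -- the inverse chart `Λ y = (c (π y), (ι s₀)⁻¹ (Sr (τ (π y), y)))`
  haveI : CompactSpace (X s₀) := hι₀.compactSpace hπ.isProperMap
  have hemb₀ : Manifold.IsSmoothEmbedding 𝓘(ℝ, EX) 𝓘(ℝ, E𝒳) ∞ (ι s₀) :=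
    Literature.Topology.FourManifolds.isSmoothEmbedding_of_injective_of_injective_mfderiv
      hι₀.contMDiff_real (by simp) hι₀.isClosedEmbedding.injective hι₀.injective_mfderiv_real
  set Λ : 𝒳 → EB × X s₀ := fun y ↦ (c (π y), invFun (ι s₀) (Sr (τ (π y), y))) with hΛ
  -- points of the tube over the ball
  have htube : ∀ y, π y ∈ c.symm '' ball (c s₀) r →
      ∃ p ∈ ball (c s₀) r, π y = c.symm p ∧ c (π y) = p ∧ y ∈ W := by
    rintro y ⟨p, hp, hpy⟩
    refine ⟨p, hp, hpy.symm, by rw [← hpy, c.right_inv (hbt hp)], ?_⟩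
    exact hfibW _ (hbV p hp) (by simpa using hpy.symm)
  -- `Sr (τ (π y), y)` lies on the central fibre
  have hSr₀ : ∀ y, π y ∈ c.symm '' ball (c s₀) r → Sr (τ (π y), y) ∈ range (ι s₀) := by
    intro y hy
    obtain ⟨p, hp, hpy, -, hyW⟩ := htube y hy
    rw [hι₀.range_eq, mem_preimage, mem_singleton_iff]
    apply hτinj (hπW _ (hSrW _ y hyW)) hs₀V
    have h := hlaw (τ (π y)) (Sr (τ (π y), y)) (hSrW _ y hyW)
    rw [hTrSr _ y hyW] at h
    rw [hτ₀]
    simpa using h.symm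
  have hΛ2 : ∀ p ∈ ball (c s₀) r, ∀ x, Λ (Φ p x) = (p, x) := by
    intro p hp x
    simp only [hΛ]
    rw [hπΦ p hp x, c.right_inv (hbt hp)]
    refine Prod.ext rfl ?_
    change invFun (ι s₀) (Sr (τ (c.symm p), Tr (τ (c.symm p), ι s₀ x))) = x
    rw [hSrTr _ _ (hι₀W x)]
    exact leftInverse_invFun hι₀.isClosedEmbedding.injective x
  have hΛ3 : ∀ y, π y ∈ c.symm '' ball (c s₀) r → Φ (Λ y).1 (Λ y).2 = y := by
    intro y hy
    obtain ⟨p, hp, hpy, hcπ, hyW⟩ := htube y hy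
    change Tr (τ (c.symm (c (π y))), ι s₀ (invFun (ι s₀) (Sr (τ (π y), y)))) = y
    rw [invFun_eq (hSr₀ y hy), hcπ, ← hpy, hTrSr _ y hyW]
  have hΛ1 : ContMDiffOn 𝓘(ℝ, E𝒳) (𝓘(ℝ, EB).prod 𝓘(ℝ, EX)) ∞ Λ (π ⁻¹' (c.symm '' ball (c s₀) r)) := by
    have hsub₁ : π ⁻¹' (c.symm '' ball (c s₀) r) ⊆ W := fun y hy ↦ (htube y hy).choose_spec.2.2.2
    have hπV : ∀ y ∈ π ⁻¹' (c.symm '' ball (c s₀) r), π y ∈ c.source := by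
      intro y hy
      obtain ⟨p, hp, hpy, -, -⟩ := htube y hy
      rw [hpy]; exact c.map_target (hbt hp)
    -- first component `c ∘ π`
    have h1 : ContMDiffOn 𝓘(ℝ, E𝒳) 𝓘(ℝ, EB) ∞ (fun y ↦ c (π y)) (π ⁻¹' (c.symm '' ball (c s₀) r)) := by
      have hcs : ContMDiffOn 𝓘(ℝ, EB) 𝓘(ℝ, EB) ∞ c c.source := by
        rw [← hcℝ, extChartAt_source]; exact contMDiffOn_extChartAt
      exact hcs.comp hπℝ.contMDiffOn fun y hy ↦ hπV y hy
    -- second component `(ι s₀)⁻¹ ∘ S`, `S y = Sr (τ (π y), y)`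
    have hS : ContMDiffOn 𝓘(ℝ, E𝒳) 𝓘(ℝ, E𝒳) ∞ (fun y ↦ Sr (τ (π y), y)) W := by
      have hpair : ContMDiffOn 𝓘(ℝ, E𝒳) ((𝓘(ℝ, EuclideanSpace ℝ (Fin (Module.finrank ℝ EB)))).prod 𝓘(ℝ, E𝒳)) ∞
          (fun y ↦ (τ (π y), y)) W :=
        ((hτ.comp hπℝ.contMDiffOn fun y hy ↦ hπW y hy).prodMk contMDiffOn_id)
      exact hSr.comp hpair fun y hy ↦ ⟨mem_univ _, hy⟩
    have h2 : ContMDiffOn 𝓘(ℝ, E𝒳) 𝓘(ℝ, EX) ∞ (fun y ↦ invFun (ι s₀) (Sr (τ (π y), y)))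
        (π ⁻¹' (c.symm '' ball (c s₀) r)) :=
      (contMDiffOn_invFun_range hemb₀).comp (hS.mono hsub₁) fun y hy ↦ hSr₀ y hy
    exact h1.prodMk h2
  refine ⟨r, Φ, Λ, hr, hbt, fun p hp ↦ hVO (hbV p hp), fun x ↦ ?_, hπΦ, ?_, himm, fun p hp ↦ ?_, fun y ↦ rfl, hΛ1,
    hΛ2, hΛ3⟩
  · -- (0) the central fibre
    change Tr (τ (c.symm (c s₀)), ι s₀ x) = ι s₀ x
    rw [c.left_inv hs₀c, hτ₀, hTr0 _ (hι₀W x)]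
  · -- (2) joint smoothness on `ball × X s₀`
    have hsymm : ContMDiffOn 𝓘(ℝ, EB) 𝓘(ℝ, EB) ∞ c.symm c.target := by
      rw [← hcℝ]; exact contMDiffOn_extChartAt_symm s₀
    have hu : ContMDiffOn 𝓘(ℝ, EB) 𝓘(ℝ, EuclideanSpace ℝ (Fin (Module.finrank ℝ EB))) ∞
        (fun p ↦ τ (c.symm p)) (ball (c s₀) r) :=
      hτ.comp (hsymm.mono hbt) fun p hp ↦ hbV p hp
    have hpair : ContMDiffOn (𝓘(ℝ, EB).prod 𝓘(ℝ, EX))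
        ((𝓘(ℝ, EuclideanSpace ℝ (Fin (Module.finrank ℝ EB)))).prod 𝓘(ℝ, E𝒳)) ∞
        (fun q : EB × X s₀ ↦ (τ (c.symm q.1), ι s₀ q.2)) (ball (c s₀) r ×ˢ univ) :=
      (hu.comp contMDiffOn_fst fun q hq ↦ hq.1).prodMk
        (hι₀.contMDiff_real.comp_contMDiffOn contMDiffOn_snd)
    refine (hTr.comp hpair fun q hq ↦ ⟨mem_univ _, hι₀W q.2⟩).congr fun q hq ↦ ?_
    rfl
  · -- (4) the diffeomorphism `X s₀ ≅ X (c⁻¹ p)`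
    obtain ⟨hsm, hinj, hd, hrange⟩ := himm p hp
    have hb : c.symm p ∈ O := hVO (hbV p hp)
    have hιb := hι _ hb
    haveI : CompactSpace (X s₀) := hι₀.compactSpace hπ.isProperMap
    haveI : CompactSpace (X (c.symm p)) := hιb.compactSpace hπ.isProperMap
    have h₁ : Manifold.IsSmoothEmbedding 𝓘(ℝ, EX) 𝓘(ℝ, E𝒳) ∞ (Φ p) :=
      Literature.Topology.FourManifolds.isSmoothEmbedding_of_injective_of_injective_mfderiv
        hsm (by simp) hinj hd
    have h₂ : Manifold.IsSmoothEmbedding 𝓘(ℝ, EX) 𝓘(ℝ, E𝒳) ∞ (ι (c.symm p)) :=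
      Literature.Topology.FourManifolds.isSmoothEmbedding_of_injective_of_injective_mfderiv
        hιb.contMDiff_real (by simp) hιb.isClosedEmbedding.injective hιb.injective_mfderiv_real
    exact exists_diffeomorph_comp_eq_of_range_eq h₁ h₂ (hrange.trans hιb.range_eq.symm)

end ChartBall

end Literature.Geometry.Kaehler

end
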